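import Mathlib
import Summits.Ventures.PercRepro2.TypedSepThreeSort

/-!
# The `{a₃, b}`-pocket class, I: the gluing and the doubly symmetrised kernel (blind cell
PercRepro2, p3 g6, 2026-08-25; `proofs/P3-BRIDGE.md` §11.21)

The doors are now `a₃` and `b`: the o-side holds `o` (side state `(a₃~o, b~o, a₃~b)` inside the
pocket, the type `SepThree.OSt`), the b-side holds both roots (side state `SepThree.BSt`, the
connections among `a₁, a₂, a₃, b` inside it).  The glued state `gluedP` is the raw output of the
two-door closure lemmas (`TypedSepThreeClosure.lean`); the `S₃ × S₃`-symmetrised kernel `dsymP`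
is POINTWISE NONNEGATIVE on valid states (`dsymP_nonneg`; not identically zero — max 16) by
`decide` on the sorted representatives of `TypedSepThreeStates` / `TypedSepThreeSort`.  The same
mechanism as the typed (SEP-3) zero (an identity across the separator, then a pointwise
`decide`), now yielding row 2′TRI's NONNEGATIVITY on a class.  Own work; standard axioms.
-/

namespace Summit.Ventures.PercRepro2

namespace CovForm

namespace PocketAB

open OneTyped SepThree

/-! ## The gluing with the doors `a₃, b` -/

/-- **The glued state** of a copy from its o-side state `(p₃, p_b, X) = (a₃~o, b~o, a₃~b)` and its
b-side state `(h₁₂, h₃₂, Y, b₁, b₂, b₃)`: with `D = X ∨ b₃` (`a₃ ~ b`),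
`a₂~a₁ = h₁₂ ∨ (D ∧ ((Y ∧ b₂) ∨ (b₁ ∧ h₃₂)))`, `a₁~a₃ = Y ∨ (D ∧ ((Y ∧ b₃) ∨ b₁))`,
`a₂~a₃ = h₃₂ ∨ (D ∧ ((h₃₂ ∧ b₃) ∨ b₂))`,
`a₁~b = b₁ ∨ (D ∧ (Y ∨ (b₁ ∧ b₃)))`, `a₂~b = b₂ ∨ (D ∧ (h₃₂ ∨ (b₂ ∧ b₃)))`, `a₃~o = p₃ ∨ (D ∧ (p_b ∨
(X ∧ p₃)))`, `b~o = p_b ∨ (D ∧ ((X ∧ p_b) ∨ p₃))`, `a_i~o = (a_i~a₃ ∧ a₃~o) ∨ (a_i~b ∧ b~o)`. -/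
def gluedP (s : OSt) (t : BSt) : St :=
  let p3 := s.1
  let pb := s.2.1
  let X := s.2.2
  let h12 := t.1
  let h32 := t.2.1
  let Y := t.2.2.1
  let b1 := t.2.2.2.1
  let b2 := t.2.2.2.2.1
  let b3 := t.2.2.2.2.2
  let D := X || b3
  let q := h12 || (D && ((Y && b2) || (b1 && h32)))
  let L3 := Y || (D && ((Y && b3) || b1))
  let H3 := h32 || (D && ((h32 && b3) || b2))
  let Lb := b1 || (D && (Y || (b1 && b3)))
  let Hb := b2 || (D && (h32 || (b2 && b3)))
  let a3o := p3 || (D && (pb || (X && p3)))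
  let bo := pb || (D && ((X && pb) || p3))
  (q, (L3 && a3o) || (Lb && bo), (H3 && a3o) || (Hb && bo), Lb, Hb, L3, H3)

/-- The kernel on glued state triples. -/
def psiP (x y w : OSt) (u v r : BSt) : ℤ := KB (gluedP x u) (gluedP y v) (gluedP w r)

/-- **The doubly symmetrised kernel** (36 terms: the o-states and the b-states permuted
independently). -/
def dsymP (x y w : OSt) (u v r : BSt) : ℤ :=
  (psiP x y w u v r + psiP x y w u r v + psiP x y w v u r + psiP x y w v r u + psiP x y w r u v +
      psiP x y w r v u) +
  (psiP x w y u v r + psiP x w y u r v + psiP x w y v u r + psiP x w y v r u + psiP x w y r u v +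
      psiP x w y r v u) +
  (psiP y x w u v r + psiP y x w u r v + psiP y x w v u r + psiP y x w v r u + psiP y x w r u v +
      psiP y x w r v u) +
  (psiP y w x u v r + psiP y w x u r v + psiP y w x v u r + psiP y w x v r u + psiP y w x r u v +
      psiP y w x r v u) +
  (psiP w x y u v r + psiP w x y u r v + psiP w x y v u r + psiP w x y v r u + psiP w x y r u v +
      psiP w x y r v u) +
  (psiP w y x u v r + psiP w y x u r v + psiP w y x v u r + psiP w y x v r u + psiP w y x r u v +
      psiP w y x r v u)

/-- `dsymP` is symmetric in the first two o-states. -/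
lemma dsymP_swapO12 (x y w : OSt) (u v r : BSt) : dsymP x y w u v r = dsymP y x w u v r := by
  unfold dsymP; ring

/-- `dsymP` is symmetric in the last two o-states. -/
lemma dsymP_swapO23 (x y w : OSt) (u v r : BSt) : dsymP x y w u v r = dsymP x w y u v r := by
  unfold dsymP; ring

/-- `dsymP` is symmetric in the first two b-states. -/
lemma dsymP_swapB12 (x y w : OSt) (u v r : BSt) : dsymP x y w u v r = dsymP x y w v u r := by
  unfold dsymP; ring

/-- `dsymP` is symmetric in the last two b-states. -/
lemma dsymP_swapB23 (x y w : OSt) (u v r : BSt) : dsymP x y w u v r = dsymP x y w u r v := by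
  unfold dsymP; ring

/-- `dsymP` is unchanged by sorting the o-states. -/
lemma dsymP_sort3O (x y w : OSt) (u v r : BSt) :
    dsymP x y w u v r = dsymP (sort3O x y w).1 (sort3O x y w).2.1 (sort3O x y w).2.2 u v r := by
  unfold sort3O
  split_ifs <;> dsimp only <;>
    first
    | rfl
    | exact dsymP_swapO12 x y w u v r
    | exact dsymP_swapO23 x y w u v r
    | exact (dsymP_swapO12 x y w u v r).trans (dsymP_swapO23 y x w u v r)
    | exact (dsymP_swapO23 x y w u v r).trans (dsymP_swapO12 x w y u v r)
    | exact ((dsymP_swapO12 x y w u v r).trans (dsymP_swapO23 y x w u v r)).trans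
        (dsymP_swapO12 y w x u v r)

/-- `dsymP` is unchanged by sorting the b-states. -/
lemma dsymP_sort3B (x y w : OSt) (u v r : BSt) :
    dsymP x y w u v r = dsymP x y w (sort3B u v r).1 (sort3B u v r).2.1 (sort3B u v r).2.2 := by
  unfold sort3B
  split_ifs <;> dsimp only <;>
    first
    | rfl
    | exact dsymP_swapB12 x y w u v r
    | exact dsymP_swapB23 x y w u v r
    | exact (dsymP_swapB12 x y w u v r).trans (dsymP_swapB23 x y w v u r)
    | exact (dsymP_swapB23 x y w u v r).trans (dsymP_swapB12 x y w u r v)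
    | exact ((dsymP_swapB12 x y w u v r).trans (dsymP_swapB23 x y w v u r)).trans
        (dsymP_swapB12 x y w v r u)

/-! ## The nonnegativity on the sorted representatives -/

/-- The nonnegativity for a fixed sorted o-triple, over the sorted b-triples. -/
def allNonnegAt (x y w : OSt) : Bool :=
  bList.all fun u => (bSorted u).all fun v => (bSorted v).all fun r =>
    decide (0 ≤ dsymP x y w u v r)

/-- Slice 0: three sorted o-triples. -/
theorem allNonnegAt_0 :
    (allNonnegAt (false, false, false) (false, false, false) (false, false, false) &&
      allNonnegAt (false, false, false) (false, false, false) (false, false, true) &&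
      allNonnegAt (false, false, false) (false, false, false) (false, true, false)) = true := by
  decide +kernel
/-- Slice 1: three sorted o-triples. -/
theorem allNonnegAt_1 :
    (allNonnegAt (false, false, false) (false, false, false) (true, false, false) &&
      allNonnegAt (false, false, false) (false, false, false) (true, true, true) &&
      allNonnegAt (false, false, false) (false, false, true) (false, false, true)) = true := by
  decide +kernel
/-- Slice 2: three sorted o-triples. -/
theorem allNonnegAt_2 :
    (allNonnegAt (false, false, false) (false, false, true) (false, true, false) &&
      allNonnegAt (false, false, false) (false, false, true) (true, false, false) &&
      allNonnegAt (false, false, false) (false, false, true) (true, true, true)) = true := by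
  decide +kernel
/-- Slice 3: three sorted o-triples. -/
theorem allNonnegAt_3 :
    (allNonnegAt (false, false, false) (false, true, false) (false, true, false) &&
      allNonnegAt (false, false, false) (false, true, false) (true, false, false) &&
      allNonnegAt (false, false, false) (false, true, false) (true, true, true)) = true := by
  decide +kernel
/-- Slice 4: three sorted o-triples. -/
theorem allNonnegAt_4 :
    (allNonnegAt (false, false, false) (true, false, false) (true, false, false) &&
      allNonnegAt (false, false, false) (true, false, false) (true, true, true) &&
      allNonnegAt (false, false, false) (true, true, true) (true, true, true)) = true := by
  decide +kernel
/-- Slice 5: three sorted o-triples. -/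
theorem allNonnegAt_5 :
    (allNonnegAt (false, false, true) (false, false, true) (false, false, true) &&
      allNonnegAt (false, false, true) (false, false, true) (false, true, false) &&
      allNonnegAt (false, false, true) (false, false, true) (true, false, false)) = true := by
  decide +kernel
/-- Slice 6: three sorted o-triples. -/
theorem allNonnegAt_6 :
    (allNonnegAt (false, false, true) (false, false, true) (true, true, true) &&
      allNonnegAt (false, false, true) (false, true, false) (false, true, false) &&
      allNonnegAt (false, false, true) (false, true, false) (true, false, false)) = true := by
  decide +kernel
/-- Slice 7: three sorted o-triples. -/
theorem allNonnegAt_7 :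
    (allNonnegAt (false, false, true) (false, true, false) (true, true, true) &&
      allNonnegAt (false, false, true) (true, false, false) (true, false, false) &&
      allNonnegAt (false, false, true) (true, false, false) (true, true, true)) = true := by
  decide +kernel
/-- Slice 8: three sorted o-triples. -/
theorem allNonnegAt_8 :
    (allNonnegAt (false, false, true) (true, true, true) (true, true, true) &&
      allNonnegAt (false, true, false) (false, true, false) (false, true, false) &&
      allNonnegAt (false, true, false) (false, true, false) (true, false, false)) = true := by
  decide +kernel
/-- Slice 9: three sorted o-triples. -/
theorem allNonnegAt_9 :
    (allNonnegAt (false, true, false) (false, true, false) (true, true, true) &&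
      allNonnegAt (false, true, false) (true, false, false) (true, false, false) &&
      allNonnegAt (false, true, false) (true, false, false) (true, true, true)) = true := by
  decide +kernel
/-- Slice 10: three sorted o-triples. -/
theorem allNonnegAt_10 :
    (allNonnegAt (false, true, false) (true, true, true) (true, true, true) &&
      allNonnegAt (true, false, false) (true, false, false) (true, false, false) &&
      allNonnegAt (true, false, false) (true, false, false) (true, true, true)) = true := by
  decide +kernel
/-- Slice 11: three sorted o-triples. -/
theorem allNonnegAt_11 :
    (allNonnegAt (true, false, false) (true, true, true) (true, true, true) &&
      allNonnegAt (true, true, true) (true, true, true) (true, true, true)) = true := by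
  decide +kernel

/-- The nonnegativity on the sorted representatives as a Boolean computation (12 slices). -/
theorem dsymP_nonneg_all : (oTriples.all fun s => allNonnegAt s.1 s.2.1 s.2.2) = true := by
  rw [oTriples_eq]
  simp only [List.all_cons, List.all_nil, Bool.and_true, Bool.and_eq_true]
  have h0 := and3 allNonnegAt_0
  have h1 := and3 allNonnegAt_1
  have h2 := and3 allNonnegAt_2
  have h3 := and3 allNonnegAt_3
  have h4 := and3 allNonnegAt_4
  have h5 := and3 allNonnegAt_5
  have h6 := and3 allNonnegAt_6
  have h7 := and3 allNonnegAt_7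
  have h8 := and3 allNonnegAt_8
  have h9 := and3 allNonnegAt_9
  have h10 := and3 allNonnegAt_10
  have h11 := (Bool.and_eq_true _ _).mp allNonnegAt_11
  exact ⟨h0.1, h0.2.1, h0.2.2, h1.1, h1.2.1, h1.2.2, h2.1, h2.2.1, h2.2.2,
    h3.1, h3.2.1, h3.2.2, h4.1, h4.2.1, h4.2.2, h5.1, h5.2.1, h5.2.2,
    h6.1, h6.2.1, h6.2.2, h7.1, h7.2.1, h7.2.2, h8.1, h8.2.1, h8.2.2,
    h9.1, h9.2.1, h9.2.2, h10.1, h10.2.1, h10.2.2, h11.1, h11.2⟩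

/-- **The doubly symmetrised kernel is nonnegative on every sorted pair of valid triples.** -/
theorem dsymP_nonneg_sorted : ∀ s ∈ oTriples, ∀ t ∈ bTriples,
    0 ≤ dsymP s.1 s.2.1 s.2.2 t.1 t.2.1 t.2.2 := by
  rintro ⟨x, y, w⟩ hs ⟨u, v, r⟩ ht
  rw [mem_oTriples] at hs
  rw [mem_bTriples] at ht
  have key := dsymP_nonneg_all
  simp only [List.all_eq_true] at key
  have h := key (x, y, w) (mem_oTriples.2 hs)
  simp only [allNonnegAt, bSorted, List.all_eq_true, decide_eq_true_eq, List.mem_filter] at h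
  exact h u ht.1.1 v ⟨ht.1.2.1, ht.2.1⟩ r ⟨ht.1.2.2, ht.2.2⟩

/-- **THE DOUBLY SYMMETRISED KERNEL IS NONNEGATIVE on valid states.** -/
theorem dsymP_nonneg (x y w : OSt) (u v r : BSt) (hx : ValidO x = true) (hy : ValidO y = true)
    (hw : ValidO w = true) (hu : ValidB u = true) (hv : ValidB v = true) (hr : ValidB r = true) :
    0 ≤ dsymP x y w u v r := by
  rw [dsymP_sort3O, dsymP_sort3B]
  exact dsymP_nonneg_sorted _ (sort3O_mem x y w hx hy hw) _ (sort3B_mem u v r hu hv hr)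

end PocketAB

end CovForm

end Summit.Ventures.PercRepro2
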